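import Literature.NumberTheory.GelbartRogawski1991.UnitaryDualPairWeilCoinvariants
import Literature.NumberTheory.Weil1964.FiniteWeilLevelFixing
import HarnessLib

-- buildfix G11b-3 recipe (LEDGER B13-1/B13-3): elaborate sequentially so the trailing `attribute [implicit_reducible]`
-- block (reducibilityCoreExt is keyed to the async environment branch) is in force at `.olean` export.
set_option Elab.async false

/-!
# Smoothness of the finite Weil representation of a dual pair and of its Weil coinvariants

Topic `NumberTheory/GelbartRogawski1991`; namespace
`Literature.NumberTheory.GelbartRogawski1991.UnitaryDualPair.WeilCoinv`.  Kernel only (definitions and theorems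
over landed tree files; 0 records, 0 named facts).

[GelbartRogawski1991, §3.1 p. 454]: the Weil representation of `Mp(𝕎_𝔸)` restricted along a (compatible) splitting of
the unitary dual pair is a SMOOTH representation — every Schwartz–Bruhat vector is fixed by a compact open subgroup.
For the finite Weil representation `finPairRep hs` of `UnitaryDualPairWeilCoinvariants.lean` (a CONTINUOUS pair
splitting `s`, `hsc : Continuous (pairSplitting … s)`) this file proves it at the level of principal congruence
subgroups `K_{U,f}(𝔪) = UnitaryGroup.finCongruenceLevel … 𝔪` (`𝔪 ≠ 0` an ideal of `𝓞_E`; open and compact,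
`UnitaryGroup.isOpen_finCongruenceLevel` / `isCompact_finCongruenceLevel`):

* `exists_finCongruenceLevel_forall_finRepMp_apply_eq_self` — the engine, in `Weil1964.finRepMp` currency: for a
  continuous `σ : U(J)(𝔸_{E,f}) →* Mp_ψ(𝕎_𝔸)ᶜᵒⁿᵗ` whose symplectic components fix the archimedean vectors, EVERY
  `v ∈ 𝒮((𝔸_F^∞)^ι)` is fixed by some `K_{U,f}(𝔪)` (a level `𝔫` of `v`, `exists_level_of_mem_schwartzBruhat`; the coset
  decomposition `v = Σ_q v(q) 𝟙_{q+𝔫𝒪̂^ι}`, `exists_eq_sum_smul_finTranslateSB_indicatorSB`; ONE level fixing the finitely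
  many coset indicators, `Weil1964.exists_finCongruenceLevel_forall_forall_finRepMp_cosetIndicatorSB_eq_self`);
* `finPairRepV_smooth`, `finPairRepW_smooth` — both members `k ↦ ω_f(s_pair((1,k),1))`, `u ↦ ω_f(s_pair(1,(1,u)))` of
  `finPairRep hs` are smooth in this sense;
* `weilCoinv_smooth` — hence the `χ`-coinvariants `Ω(s, χ) = weilCoinv χ hs` are a smooth `U(J_V)(𝔸_{F,f})`-module:
  every class is fixed by some `K_{U,f}(𝔪)`; `weilCoinv_comp_smooth` — the same for the pull-back along any continuous
  homomorphism `ι : G →* U(J_V)(𝔸_{F,f})` (every class is fixed by an OPEN subgroup of `G`).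

This is the «smooth» clause that [Liu2021, Def. 4.11 (l. 2092–2096)] records for the restricted tensor product
`ω(μ, ε, χ)`; admissibility and the non-vanishing / irreducibility of [Liu2021, App. D Lemma D.1 (1)] are NOT treated.

## References
* [GelbartRogawski1991] S. Gelbart, J. Rogawski, *L-functions and Fourier–Jacobi coefficients for the unitary group
  U(3)*, Invent. Math. 105 (1991), §3.1 p. 454.
* [Weil1964] A. Weil, *Sur certains groupes d'opérateurs unitaires*, Acta Math. 111 (1964), Chap. III n° 37–39.
* [Liu2021] Y. Liu, *Fourier–Jacobi cycles and arithmetic relative trace formula*, Camb. J. Math. 9 (2021) =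
  arXiv:2102.11518, Def. 4.11.
-/

noncomputable section

namespace Literature.NumberTheory.GelbartRogawski1991.UnitaryDualPair.WeilCoinv

open Literature.NumberTheory.GelbartRogawski1991 Literature.NumberTheory.GelbartRogawski1991.UnitaryDualPair
open Literature.NumberTheory.Automorphic Literature.NumberTheory.Weil1964
open scoped Kronecker
open NumberField NumberField.mixedEmbedding IsDedekindDomain
open Literature.RepresentationTheory

/-! ### §1. Every finite Schwartz–Bruhat vector is fixed by a principal congruence level -/

section Engine

variable {F : Type} [Field F] [NumberField F] {ι : Type} [Fintype ι] [DecidableEq ι]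
  {T : Matrix ι ι (AdeleRing (𝓞 F) F)}
variable {F₁ E : Type} [Field F₁] [Field E] [NumberField E] [Algebra F₁ E] {c : E ≃ₐ[F₁] E} {N : ℕ}
  {J : Matrix (Fin N) (Fin N) E}

/-- **Smooth vectors**: for a continuous `σ : U(J)(𝔸_{E,f}) →* Mp_ψ(𝕎_𝔸)ᶜᵒⁿᵗ` whose symplectic components fix the
archimedean vectors, every `v ∈ 𝒮((𝔸_F^∞)^ι)` is FIXED by the finite Weil representation `finRepMp σ` on some
principal congruence level `K_{U,f}(𝔪)`, `𝔪 ≠ 0`. [cite: GelbartRogawski1991, §3.1 p. 454] -/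
theorem exists_finCongruenceLevel_forall_finRepMp_apply_eq_self (hT : IsUnit T)
    (σ : UnitaryGroup.finAdelic F₁ E c N J →* adelicMpCont F ι T) (hσ : Continuous σ)
    (harch : ∀ (k : UnitaryGroup.finAdelic F₁ E c N J) (a w : ι → mixedSpace F),
      (adelicMpCont.proj F ι T (σ k)).1 (archVec F ι a, archVec F ι w) = (archVec F ι a, archVec F ι w))
    (v : FinSB F ι) :
    ∃ 𝔪 : Ideal (𝓞 E), 𝔪 ≠ 0 ∧ ∀ k ∈ UnitaryGroup.finCongruenceLevel F₁ E c N J 𝔪, finRepMp hT σ harch k v = v := by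
  classical
  -- a level of `v` and its coset decomposition
  obtain ⟨𝔫, -, hlev⟩ := exists_level_of_mem_schwartzBruhat F v.2
  obtain ⟨s, hs⟩ := exists_eq_sum_smul_finTranslateSB_indicatorSB (piLevelIdeal F ι 𝔫) (isOpen_piLevelIdeal F 𝔫)
    (isCompact_piLevelIdeal F ι 𝔫) v hlev
  -- ONE principal congruence level fixing the finitely many coset indicators
  obtain ⟨𝔪, h𝔪, hfix⟩ := exists_finCongruenceLevel_forall_forall_finRepMp_cosetIndicatorSB_eq_self (A := ↥s) hT σ hσ
    harch (fun q => (q.1.out : ι → FiniteAdeleRing (𝓞 F) F)) (fun _ => 𝔫)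
  refine ⟨𝔪, h𝔪, fun k hk => ?_⟩
  have hs' : v = ∑ q ∈ s, ((v : (ι → FiniteAdeleRing (𝓞 F) F) → ℂ) q.out) •
      cosetIndicatorSB F ι (q.out : ι → FiniteAdeleRing (𝓞 F) F) 𝔫 := hs
  conv_lhs => rw [hs']
  rw [map_sum]
  conv_rhs => rw [hs']
  exact Finset.sum_congr rfl fun q hq => by rw [map_smul, hfix ⟨q, hq⟩ k hk]

end Engine

/-! ### §2. The two members of `ω_f ∘ s_pair` are smooth -/

variable (F E : Type) [Field F] [NumberField F] [Field E] [NumberField E] [Algebra F E]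
variable (c : E ≃ₐ[F] E) (N M : ℕ) {n : ℕ} (e : Fin N × Fin M ≃ Fin n)
variable (JV : Matrix (Fin N) (Fin N) E) (JW : Matrix (Fin M) (Fin M) E)
variable {TV : Matrix (Fin N) (Fin N) F} {TW : Matrix (Fin M) (Fin M) F}
variable [Algebra.IsQuadraticExtension F E] {δ : E} (hcδ : c δ = -δ) (hδ : δ ≠ 0) {d : F}
  (hd : δ * δ = algebraMap F E d) (hV : TV.IsSymm) (hW : TW.IsSymm) (hVd : IsUnit TV.det) (hWd : IsUnit TW.det)
  (hJV : JV = TV.map (algebraMap F E)) (hJW : JW = TW.map (algebraMap F E))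
  {s : UnitaryGroup.adelicPair F E c N M JV JW →* adelicMpCont F (Fin n) (adelicGram F e TV TW)}

omit [Algebra.IsQuadraticExtension F E] in
/-- continuity of `ω-splitting ∘ finPairToAdelic`: `pairSmall₁ s ∘ (k, u) ↦ ((1,k), (1,u))` is continuous for a
continuous pair splitting. [cite: GelbartRogawski1991, §3.1 Prop. 3.1.1 p. 455] -/
theorem continuous_pairSmall₁_comp_finPairToAdelic (hsc : Continuous (pairSplitting F E c N M e JV JW s)) :
    Continuous ((pairSmall₁ F E c N M e JV JW s).comp (finPairToAdelic F E c N M JV JW)) :=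
  (continuous_pairSmall₁ F E c N M e JV JW hsc).comp
    ((UnitaryGroup.continuous_finAdelicToAdelic F E c N JV).prodMap (UnitaryGroup.continuous_finAdelicToAdelic F E c M JW))

/-- **The `U(J_V)(𝔸_{F,f})`-member of `ω_f ∘ s_pair` is SMOOTH** (continuous pair splitting): every
`v ∈ 𝒮((𝔸_F^∞)^{N M})` is fixed by `finPairRepV hs` on some principal congruence level `K_{U(J_V),f}(𝔪)`, `𝔪 ≠ 0`.
[cite: GelbartRogawski1991, §3.1 p. 454] -/
theorem finPairRepV_smooth (hsc : Continuous (pairSplitting F E c N M e JV JW s))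
    (hs : (splittingDatum F E c N M e JV JW hcδ hδ hd hV hW hVd hWd hJV hJW).IsCompatible s)
    (v : FinSB F (Fin N × Fin M)) :
    ∃ 𝔪 : Ideal (𝓞 E), 𝔪 ≠ 0 ∧ ∀ k ∈ UnitaryGroup.finCongruenceLevel F E c N JV 𝔪,
      finPairRepV F E c N M e JV JW hcδ hδ hd hV hW hVd hWd hJV hJW hs k v = v := by
  let σ₀ := (pairSmall₁ F E c N M e JV JW s).comp (finPairToAdelic F E c N M JV JW)
  let σ := σ₀.comp (MonoidHom.inl _ _)
  have hσ : Continuous σ :=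
    (continuous_pairSmall₁_comp_finPairToAdelic F E c N M e JV JW hsc).comp (continuous_id.prodMk continuous_const)
  have harch : ∀ (k : UnitaryGroup.finAdelic F E c N JV) (a w : Fin N × Fin M → mixedSpace F),
      (adelicMpCont.proj F (Fin N × Fin M) _ (σ k)).1 (archVec F (Fin N × Fin M) a, archVec F (Fin N × Fin M) w) =
        (archVec F (Fin N × Fin M) a, archVec F (Fin N × Fin M) w) :=
    fun k a w => proj_pairSmall₁_finAdelic_apply_archVec F E c N M e JV JW hcδ hδ hd hV hW hVd hWd hJV hJW hs k 1 a w
  -- `finPairRepV k` IS `finRepMp σ k`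
  have hrep : ∀ k, finPairRepV F E c N M e JV JW hcδ hδ hd hV hW hVd hWd hJV hJW hs k =
      finRepMp (isUnit_kronecker_map F N hVd hWd) σ harch k := fun k => rfl
  obtain ⟨𝔪, h𝔪, hfix⟩ := exists_finCongruenceLevel_forall_finRepMp_apply_eq_self
    (isUnit_kronecker_map F N hVd hWd) σ hσ harch v
  exact ⟨𝔪, h𝔪, fun k hk => by rw [hrep]; exact hfix k hk⟩

/-- **The `U(J_W)(𝔸_{F,f})`-member of `ω_f ∘ s_pair` is SMOOTH** (continuous pair splitting).
[cite: GelbartRogawski1991, §3.1 p. 454] -/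
theorem finPairRepW_smooth (hsc : Continuous (pairSplitting F E c N M e JV JW s))
    (hs : (splittingDatum F E c N M e JV JW hcδ hδ hd hV hW hVd hWd hJV hJW).IsCompatible s)
    (v : FinSB F (Fin N × Fin M)) :
    ∃ 𝔪 : Ideal (𝓞 E), 𝔪 ≠ 0 ∧ ∀ u ∈ UnitaryGroup.finCongruenceLevel F E c M JW 𝔪,
      finPairRepW F E c N M e JV JW hcδ hδ hd hV hW hVd hWd hJV hJW hs u v = v := by
  let σ₀ := (pairSmall₁ F E c N M e JV JW s).comp (finPairToAdelic F E c N M JV JW)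
  let σ := σ₀.comp (MonoidHom.inr _ _)
  have hσ : Continuous σ :=
    (continuous_pairSmall₁_comp_finPairToAdelic F E c N M e JV JW hsc).comp (continuous_const.prodMk continuous_id)
  have harch : ∀ (u : UnitaryGroup.finAdelic F E c M JW) (a w : Fin N × Fin M → mixedSpace F),
      (adelicMpCont.proj F (Fin N × Fin M) _ (σ u)).1 (archVec F (Fin N × Fin M) a, archVec F (Fin N × Fin M) w) =
        (archVec F (Fin N × Fin M) a, archVec F (Fin N × Fin M) w) :=
    fun u a w => proj_pairSmall₁_finAdelic_apply_archVec F E c N M e JV JW hcδ hδ hd hV hW hVd hWd hJV hJW hs 1 u a w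
  have hrep : ∀ u, finPairRepW F E c N M e JV JW hcδ hδ hd hV hW hVd hWd hJV hJW hs u =
      finRepMp (isUnit_kronecker_map F N hVd hWd) σ harch u := fun u => rfl
  obtain ⟨𝔪, h𝔪, hfix⟩ := exists_finCongruenceLevel_forall_finRepMp_apply_eq_self
    (isUnit_kronecker_map F N hVd hWd) σ hσ harch v
  exact ⟨𝔪, h𝔪, fun u hu => by rw [hrep]; exact hfix u hu⟩

/-- open-compact form for the `U(J_V)`-member: every `v` is fixed by a COMPACT OPEN subgroup.
[cite: GelbartRogawski1991, §3.1 p. 454] -/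
theorem exists_isOpen_isCompact_forall_finPairRepV_apply_eq_self (hsc : Continuous (pairSplitting F E c N M e JV JW s))
    (hs : (splittingDatum F E c N M e JV JW hcδ hδ hd hV hW hVd hWd hJV hJW).IsCompatible s)
    (v : FinSB F (Fin N × Fin M)) :
    ∃ K : Subgroup (UnitaryGroup.finAdelic F E c N JV),
      IsOpen (K : Set (UnitaryGroup.finAdelic F E c N JV)) ∧ IsCompact (K : Set (UnitaryGroup.finAdelic F E c N JV)) ∧
      ∀ k ∈ K, finPairRepV F E c N M e JV JW hcδ hδ hd hV hW hVd hWd hJV hJW hs k v = v := by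
  obtain ⟨𝔪, h𝔪, hfix⟩ := finPairRepV_smooth F E c N M e JV JW hcδ hδ hd hV hW hVd hWd hJV hJW hsc hs v
  exact ⟨_, UnitaryGroup.isOpen_finCongruenceLevel F E c N JV h𝔪, UnitaryGroup.isCompact_finCongruenceLevel F E c N JV h𝔪,
    hfix⟩

/-! ### §3. The Weil coinvariants are a smooth `U(J_V)(𝔸_{F,f})`-module -/

variable (χ : UnitaryGroup.finAdelic F E c M JW →* ℂˣ)

/-- **`Ω(s, χ) = weilCoinv χ hs` is SMOOTH**: every class in the `χ`-coinvariants is fixed by `U(J_V)(𝔸_{F,f})` on some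
principal congruence level `K_{U(J_V),f}(𝔪)`, `𝔪 ≠ 0` (lift a representative, `TwistedCoinv.mk_surjective`, and use
`finPairRepV_smooth`; `weilCoinv k (mk f) = mk (finPairRepV k f)`). This is the «smooth» clause of
[Liu2021, Def. 4.11] for the finite-adelic `ω(μ, ε, χ)`. [cite: GelbartRogawski1991, §3.1 p. 454; Liu2021, Def. 4.11 (l. 2092–2096)] -/
theorem weilCoinv_smooth (hsc : Continuous (pairSplitting F E c N M e JV JW s))
    (hs : (splittingDatum F E c N M e JV JW hcδ hδ hd hV hW hVd hWd hJV hJW).IsCompatible s)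
    (x : TwistedCoinv.Coinv (finPairRepW F E c N M e JV JW hcδ hδ hd hV hW hVd hWd hJV hJW hs) χ) :
    ∃ 𝔪 : Ideal (𝓞 E), 𝔪 ≠ 0 ∧ ∀ k ∈ UnitaryGroup.finCongruenceLevel F E c N JV 𝔪,
      weilCoinv F E c N M e JV JW hcδ hδ hd hV hW hVd hWd hJV hJW χ hs k x = x := by
  obtain ⟨f, rfl⟩ := TwistedCoinv.mk_surjective (finPairRepW F E c N M e JV JW hcδ hδ hd hV hW hVd hWd hJV hJW hs) χ x
  obtain ⟨𝔪, h𝔪, hfix⟩ := finPairRepV_smooth F E c N M e JV JW hcδ hδ hd hV hW hVd hWd hJV hJW hsc hs f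
  refine ⟨𝔪, h𝔪, fun k hk => ?_⟩
  rw [weilCoinv_mk, ← finPairRepV_apply, hfix k hk]

/-- open-compact form: every class of `Ω(s, χ)` is fixed by a COMPACT OPEN subgroup of `U(J_V)(𝔸_{F,f})`.
[cite: GelbartRogawski1991, §3.1 p. 454; Liu2021, Def. 4.11 (l. 2092–2096)] -/
theorem exists_isOpen_isCompact_forall_weilCoinv_apply_eq_self (hsc : Continuous (pairSplitting F E c N M e JV JW s))
    (hs : (splittingDatum F E c N M e JV JW hcδ hδ hd hV hW hVd hWd hJV hJW).IsCompatible s)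
    (x : TwistedCoinv.Coinv (finPairRepW F E c N M e JV JW hcδ hδ hd hV hW hVd hWd hJV hJW hs) χ) :
    ∃ K : Subgroup (UnitaryGroup.finAdelic F E c N JV),
      IsOpen (K : Set (UnitaryGroup.finAdelic F E c N JV)) ∧ IsCompact (K : Set (UnitaryGroup.finAdelic F E c N JV)) ∧
      ∀ k ∈ K, weilCoinv F E c N M e JV JW hcδ hδ hd hV hW hVd hWd hJV hJW χ hs k x = x := by
  obtain ⟨𝔪, h𝔪, hfix⟩ := weilCoinv_smooth F E c N M e JV JW hcδ hδ hd hV hW hVd hWd hJV hJW χ hsc hs x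
  exact ⟨_, UnitaryGroup.isOpen_finCongruenceLevel F E c N JV h𝔪, UnitaryGroup.isCompact_finCongruenceLevel F E c N JV h𝔪,
    hfix⟩

/-- **pulled back along a continuous homomorphism** `ι : G →* U(J_V)(𝔸_{F,f})` (e.g. the coordinate identification
`U(V)(𝔸_{L⁺,f}) →* U(J_V)(𝔸_{L⁺,f})` of a hermitian space with a chosen basis): every class of `Ω(s, χ)` is fixed, under
`weilCoinv χ hs ∘ ι`, by an OPEN subgroup of `G`. [cite: GelbartRogawski1991, §3.1 p. 454; Liu2021, Def. 4.11 (l. 2092–2096)] -/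
theorem weilCoinv_comp_smooth {G : Type*} [Group G] [TopologicalSpace G] (ι : G →* UnitaryGroup.finAdelic F E c N JV)
    (hι : Continuous ι) (hsc : Continuous (pairSplitting F E c N M e JV JW s))
    (hs : (splittingDatum F E c N M e JV JW hcδ hδ hd hV hW hVd hWd hJV hJW).IsCompatible s)
    (x : TwistedCoinv.Coinv (finPairRepW F E c N M e JV JW hcδ hδ hd hV hW hVd hWd hJV hJW hs) χ) :
    ∃ K : Subgroup G, IsOpen (K : Set G) ∧
      ∀ g ∈ K, (weilCoinv F E c N M e JV JW hcδ hδ hd hV hW hVd hWd hJV hJW χ hs).comp ι g x = x := by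
  obtain ⟨K, hK, -, hfix⟩ :=
    exists_isOpen_isCompact_forall_weilCoinv_apply_eq_self F E c N M e JV JW hcδ hδ hd hV hW hVd hWd hJV hJW χ hsc hs x
  refine ⟨K.comap ι, ?_, fun g hg => hfix (ι g) (Subgroup.mem_comap.1 hg)⟩
  rw [Subgroup.coe_comap]
  exact hK.preimage hι

/-! ### Build-lane note (ops-buildfix G11b-3 recipe, LEDGER B13-1, 2026-08-21)
`lean -o` (the hub build lane, never `lean`/the gate check) runs Lean 4.32's library-suggestion indexers
(`Lean.LibrarySuggestions.SymbolFrequency` / `SineQuaNon`, from their `exportEntriesFn`) over the statement of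
every local theorem that is not a denied premise; on this family's statements (very large dependent binder
telescopes through the theta-kernel / dual-pair data) that fold runs for tens of minutes to hours and the build
lane kills the job (incident G11b-3, run/shared/lean/ops/buildfix/G11b-3-DOSSIER.md). `isDeniedPremise` skips
`[implicit_reducible]` constants before any fold, and a reducibility status on a *theorem* is inert (Meta never
unfolds `thmInfo`; the kernel ignores the attribute), so the public theorems of this file are tagged
`[implicit_reducible]` purely to keep them out of that index. Only other effect: they are not offered by
`+suggestions` premise selectors. No statement or proof is changed; superseded if the operator lands a
deny-list form (`HarnessLib.PremiseIndex`). -/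
set_option allowUnsafeReducibility true in
attribute [implicit_reducible]
  exists_finCongruenceLevel_forall_finRepMp_apply_eq_self
  continuous_pairSmall₁_comp_finPairToAdelic finPairRepV_smooth finPairRepW_smooth
  exists_isOpen_isCompact_forall_finPairRepV_apply_eq_self weilCoinv_smooth
  exists_isOpen_isCompact_forall_weilCoinv_apply_eq_self weilCoinv_comp_smooth

end Literature.NumberTheory.GelbartRogawski1991.UnitaryDualPair.WeilCoinv
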